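import Summits.BirchSwinnertonDyer.BirchSwinnertonDyer.Theorems.PrintX11aNonSurjEulerHalfOfMu
import Summits.BirchSwinnertonDyer.BirchSwinnertonDyer.Theorems.PrintX11aNonSurjMuAnHardDefs
import Literature.NumberTheory.EllipticCurves.Rank1Residual.CyclotomicWindingSpan
import Summits.BirchSwinnertonDyer.BirchSwinnertonDyer.Theorems.SmallImageMuTransferAnalyticMuZeroX9TeichSpanDefs
import Literature.NumberTheory.EllipticCurves.Rank1Residual.MuLambdaCarriers
import Summits.BirchSwinnertonDyer.BirchSwinnertonDyer.Theorems.PrintX11aMuCosetDoorUnit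
import Summits.BirchSwinnertonDyer.Rank1Residual.Additive.PlusSymbolIntegrality
import HarnessLib

/-!
# Line «multteich5» for the child crux U5 = `PrintX11a.UpperNonSurjFive` (item stmt-BirchSwinnertonDyer-20614)
# of route `route-BirchSwinnertonDyer-PrintX11a` — ideator seat bsd-idea-17 (lens «transfer»), 2026-08-28

BSD is not proved by any of this; nothing is asserted about any curve; the four `sorry`s below are the stubs;
the two compositions (`muAnHardFive_of_multTeich`, `UpperNonSurjFive_of`) are real proofs.

## The transfer (sibling programme ⟶ this crux)

SIBLING (good ordinary `p ≥ 5`, class X9; in the tree MODULO ONE displayed conjecture): CONJ B⁰ `TeichSpan.TeichSpanGenAll`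
(Teichmüller-packet span, census 61/61 for `p ∈ {5,7}`, `N ≤ 1216`) ⟹ `teichOrbitNonConstantAt_of_teichSpanGenAll` ⟹
`muAnZeroAt_of_teichOrbitNonConstantAt` (the `ω⁰` branch), with the winding non-constancy input supplied input-free by
THEOREM B (`cycWindingNonConstantAt_of_odd`).  For `p ≥ 5` one unit symbol only gives SOME even branch `μ = 0`
(`PrintX9EvenBranchMuZeroInputFree`); the `ω⁰` branch needs a unit TEICHMÜLLER ORBIT SUM `A_n(u) = Σ_η [ηu/pⁿ]⁺`.

THIS CRUX lives at MULTIPLICATIVE `p ∈ {5, 7}` (`p ∥ N`, images `5Ns/5S4/7Ns`).  Dictionary (as in «multspan3» on U3, plus packets):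
* cusp class of `0` ↦ cusp class of `1/p`; good `|d| = pⁿ` (`γ0 = b/pⁿ`) ↦ MULT-GOOD of exact level `n`:
  `c + p·d = pⁿ` (`γ(1/p) = ν/pⁿ`, `ν = a + p·b`, `p ∤ ν` automatically);
* Teichmüller packet (`p − 1` good elements, `b`-entries a Teichmüller coset mod `pⁿ`) ↦ MULT packet (`p − 1` mult-good
  elements of level `n`, numerators `ν` a Teichmüller coset mod `pⁿ`); under `γ ↦ m(γ)/2 = [γ(1/p)]⁺ − [1/p]⁺` a packet
  product goes to `A_n(u) − (p−1)[1/p]⁺`, so a QUOTIENT of two packet products goes to `A_n(u) − A_{n'}(u')` exactly;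
* B⁰ + THEOREM B (two inputs at good level) ↦ ONE span statement `MultTeichSpanGen M p`, stated — as B⁰ is — on the PLUS
  SIDE: for every `γ ∈ Γ₁'(pM)` the `ι`-norm `γ·γ^ι` (`TeichSpan.iotaGamma0`) lies in `⟨packet quotients ∪ finite-order ∪ trace ±2 ∪
  p-th powers⟩ · [Γ₀(pM), Γ₀(pM)]`; homologically: the packet-quotient classes span `H₁(X₀(pM);𝔽_p)⁺` modulo Eisenstein characters.
  (Packet-quotient classes are `ι`-INVARIANT, so the naive two-sided `SpanModBy (pM) p {packet quotients}` is FALSE as soon as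
  `g(X₀(pM)) ≥ 1` — killed by every odd character; CENSUS of this seat, exact Manin-symbol linear algebra mod `p`
  (`folder/census/manin.py`): at every Eisenstein-free level tested the quotient classes of levels `n ≤ 3` span EXACTLY the plus
  part, rank `= g`: `p = 5`: `pM ∈ {15,20,30,35,40,45,60,65,70}`; `p = 7`: `pM ∈ {14,21,28,35,42,63,70}` — 16/16 levels.)
* two-root stabilised measure ↦ ONE-root Mazur–Tate–Teitelbaum measure: the `n`-th Riemann sum of the `ω⁰` branch has
  coefficients `a_p^{-n}·A_n(u)`, `a_p = ±1`, so ONE unit orbit sum of level `≥ 1` is `μ = 0` (no orbit non-constancy /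
  collapse step: EASIER than X9's AN-S1).
FIRST NON-TRANSFERRING STEP = `stub_multTeichSpan_five/_seven` (B⁰ at multiplicative level; B⁰ itself is OPEN at good level — honest:
this line is conditional in the same currency as the X9 line of record, one conjecture of elementary group theory).

## Stubs (5) and compositions (v5: S3 is REAL — the orbit-unit ⟹ μ step is PROVED class-wide through the cell's coset door)
S1₅ `stub_multTeichSpan_five`, S1₇ `stub_multTeichSpan_seven` (THE cruxes of the line: B⁰^mult at the two primes the U5 census
meets; censused 14 + 9 levels) and S1ᵥ `stub_le_seven_of_classX11a_nonSurj` (v4: VACUITY of the crux beyond `p = 7` — Tate inertia +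
Dickson + Bilu–Parent–Rebolledo / BDMTV; replaces v3's exposure stub `_eleven_le`) · S2
`stub_orbitUnit_of_multTeichSpan` (`p`-generic Stevens bridge for a non-Eisenstein `γ ∈ Γ₁'`, the `ι`-norm trick of X9 §D, packets read
at the cusp `1/p`; M-sized) · S4 `stub_pubFactsAn` (shared with «finemu5»/«hardlocus5»).  S3 is no longer a stub:
`muAnZeroAt_of_orbitUnit` / `multMuAn_of_orbitUnit` (orbit unit ⟹ `X11a.MuAnZeroAt` ⟹ `MultMuAnAt`, `p`-generic, modulo Mazur 1978 Cor. 4.1 only) are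
PROVED below from p3's `PrintX11aMuCosetCertificate`/`DoorUnit` + `Additive.norm_ratPlusSymbol_le_one_of_irreducible` + `isMultPAdicLFunctionOf_one_iff`.
Real proofs: `muAnZeroAt_of_orbitUnit`, `multMuAnAt_of_muAnZeroAt`, `multMuAn_of_orbitUnit` (S3ᴿ), `multTeichSpan_of_classX11a_nonSurj` (dispatch `p ∈ {5,7}` by S1ᵥ + `interval_cases`), `UpperNonSurjFive_of_orbitUnit` (FALLBACK with the eigen-localised hypothesis
displayed), `muAnHardFive_of_multTeich : Theorems.X11aNonSurjMuAnHardFive` (closes the μ-road's registered hardest stub of «finemu5»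
BY NAME), `UpperNonSurjFive_of : Theses.PrintX11a.UpperNonSurjFive` (the crux).
BENEFICIARIES of S2+S3 once landed (book once): every consumer of a unit-orbit-sum ⟹ `MultMuAnAt` lemma at odd multiplicative `p` —
`Theorems.X11aNonSurjMuAn`, `X11aNonSurjMuAnAtThree`, `X11aNonSurjMuAnHardFive/Three` (PrintX11aNonSurjEulerHalfBranchesDefs /
MuAnHardDefs), `PrintX11aNonSurjEulerHalfOfBranches`, `PrintX11aHardLocusRecordsFive5/6/7`, and the μ-road stubs of the lines
finemu3/finemu5/cartan3/cartan5/multspan3.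
-/

-- the summit namespace repeats `BirchSwinnertonDyer` by design (summit = problem); linter moot
set_option linter.dupNamespace false
set_option autoImplicit false

noncomputable section

open scoped Classical NumberField MatrixGroups ModularForm

open CongruenceSubgroup WeierstrassCurve Field
  Literature.NumberTheory.EllipticCurves
  Literature.NumberTheory.EllipticCurves.ModularForms
  Literature.NumberTheory.EllipticCurves.Rank1Residual
  Literature.NumberTheory.EllipticCurves.Rank1Residual.Typed
  Literature.NumberTheory.EllipticCurves.Wuthrich2014
  Literature.NumberTheory.EllipticCurves.SteinWuthrich2013
  Literature.NumberTheory.EllipticCurves.Greenberg1999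
  Literature.NumberTheory.EllipticCurves.Kato2004
  Summit.BirchSwinnertonDyer.Rank1Residual
  Summit.BirchSwinnertonDyer.Rank1Residual.X11b
  Summit.BirchSwinnertonDyer.BirchSwinnertonDyer
  Summit.BirchSwinnertonDyer.BirchSwinnertonDyer.Cruxes.AnalyticMuZeroX9

namespace Summit.BirchSwinnertonDyer.BirchSwinnertonDyer.Cruxes.UpperNonSurjFive.MultTeich

/-! ### The transferred objects -/

/-- Numerator `ν(γ) = a + p·b` of `γ(1/p) = (a + p b)/(c + p d)`. -/
def numEntry {N : ℕ} (p : ℕ) (γ : Gamma0 N) : ℤ :=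
  ((γ : SL(2, ℤ)) 0 0 : ℤ) + (p : ℤ) * ((γ : SL(2, ℤ)) 0 1 : ℤ)

/-- Denominator `c + p·d` of `γ(1/p)`. -/
def denEntry {N : ℕ} (p : ℕ) (γ : Gamma0 N) : ℤ :=
  ((γ : SL(2, ℤ)) 1 0 : ℤ) + (p : ℤ) * ((γ : SL(2, ℤ)) 1 1 : ℤ)

/-- **MULT Teichmüller packet of level `n`**: `p − 1` elements of `Γ₀(N)` carrying the cusp `1/p` to cusps `ν/pⁿ` (exact
denominator `pⁿ`) whose numerators are pairwise distinct mod `pⁿ` with a common `(p−1)`-th power — i.e. run once through a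
Teichmüller coset `u·μ_{p−1} ⊂ (ℤ/pⁿ)ˣ`.  The transfer of `TeichSpan.IsTeichPacket` (`d = pⁿ`, `b`-entries a coset). -/
def IsMultTeichPacket (N p n : ℕ) (l : List (Gamma0 N)) : Prop :=
  l.length = p - 1 ∧ (∀ g ∈ l, denEntry p g = (p : ℤ) ^ n) ∧
    (l.map fun g => ((numEntry p g : ℤ) : ZMod (p ^ n))).Nodup ∧
    ∃ c : ZMod (p ^ n), ∀ g ∈ l, ((numEntry p g : ℤ) : ZMod (p ^ n)) ^ (p - 1) = c

/-- Products of mult packets of all levels `n ≥ 1` (under `γ ↦ [γ(1/p)]⁺ − [1/p]⁺`: `A_n(u) − (p−1)[1/p]⁺`). -/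
def multTeichPacketProducts (N p : ℕ) : Set (Gamma0 N) :=
  {γ | ∃ (n : ℕ) (l : List (Gamma0 N)), 1 ≤ n ∧ IsMultTeichPacket N p n l ∧ γ = l.prod}

/-- Quotients of two packet products (under the same map: `A_n(u) − A_{n'}(u')`, the base-cusp term cancels). -/
def multTeichPacketQuotients (N p : ℕ) : Set (Gamma0 N) :=
  {γ | ∃ π ∈ multTeichPacketProducts N p, ∃ π' ∈ multTeichPacketProducts N p, γ = π * π'⁻¹}

/-- **B⁰ at multiplicative level `p·M`** (the first non-transferring step, as a predicate; PLUS SIDE, the shape of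
`TeichSpan.TeichSpanGen` with `Γ₁'(pM)` in place of the good elements and packet QUOTIENTS in place of packet products): for every
`γ ∈ Γ₁'(pM)` the `ι`-norm `γ·γ^ι` lies in `⟨packet quotients ∪ finite-order ∪ trace ±2 ∪ p-th powers⟩ · [Γ₀(pM), Γ₀(pM)]`.  Dually: every
additive character `H₁(X₀(pM);ℤ) → 𝔽_p` killing the packet-quotient classes has EISENSTEIN even part.  (Not the two-sided `SpanModBy`: the
quotient classes are `ι`-invariant; see the census in the module docstring.) [cite: Manin1972, Prop. 1.4] -/
def MultTeichSpanGen (M p : ℕ) : Prop :=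
  ∀ γ : Gamma0 (p * M), γ ∈ Gamma1' (p * M) →
    γ * TeichSpan.iotaGamma0 γ ∈
      Subgroup.closure (multTeichPacketQuotients (p * M) p ∪ trivialGens (p * M) ∪ pthPowers (p * M) p) ⊔
        commutator (Gamma0 (p * M))

/-- **Transferred carrier**: for the newform `f` of `E`, some Teichmüller orbit sum `A_n(a)` of level `n ≥ 1`
(`Rank1Residual.teichOrbitSum`) is a `p`-adic unit. -/
def MultTeichOrbitUnitAt (W : WeierstrassCurve ℚ) (p : ℕ) [Fact p.Prime] : Prop :=
  ∀ {N : ℕ} [NeZero N] (f : CuspForm (Gamma0 N) 2), IsNewformOf W f →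
    ∃ n : ℕ, 1 ≤ n ∧ ∃ a : (ZMod (p ^ n))ˣ, 1 ≤ ‖((teichOrbitSum f p n (a : ZMod (p ^ n)) : ℚ) : ℚ_[p])‖

/-- **The μ-claim of the crux in its native shape** (verbatim tail of `Theorems.X11aNonSurjMuAnHardFive`, one pair). -/
def MultMuAnAt (W : WeierstrassCurve ℚ) [W.IsElliptic] (p : ℕ) [Fact p.Prime] : Prop :=
  ∀ {N : ℕ} [NeZero N] (f : CuspForm (Gamma0 N) 2), IsNewformOf W f →
    ∀ (ϖ : ℚ), (ϖ : ℝ) * W.realPeriodRat = plusPeriod f →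
    ∀ (a : ℚ_[p]) (L : PowerSeries ℚ_[p]),
      (W.HasSplitMultiplicativeReductionAtPrime p → a = 1) →
      (¬ W.HasSplitMultiplicativeReductionAtPrime p → a = -1) →
      IsMultPAdicLFunctionOf f p a L →
      ∃ n : ℕ, ‖PowerSeries.coeff n (PowerSeries.C ((ϖ : ℚ) : ℚ_[p]) * L)‖ = 1

/-! ### The six stubs (v4: S1 per prime `5`, `7` + the vacuity stub S1ᵥ `p ≤ 7`; S2/S3 `p`-generic, S3 shared verbatim with «multspan3») -/

/-- **stub S1₅ (THE crux of this line at `p = 5`; OPEN; pure group theory of `Γ₀(5M)`)**: B⁰ at multiplicative level 5, plus side —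
for every `M` prime to `5` and every `γ ∈ Γ₁'(5M)`: `γ·γ^ι ∈ ⟨packet quotients ∪ finite-order ∪ trace ±2 ∪ 5-th powers⟩ · [Γ₀(5M), Γ₀(5M)]`.
It folds the two good-level inputs of the X9 programme (THEOREM B, proved; CONJ B⁰, open, census 61/61) into one statement one conjugation
away (`g ↦ T⁻¹·diag(p,1)·g·diag(p,1)⁻¹·T` carries `Γ₀(pM)` onto `{g ∈ Γ₀(M) : a + c ≡ b + d (p)}` and mult packets onto good packets
`d = pⁿ`); implied by (THEOREM B^mult ∧ B⁰ over mult-good elements) since `γ ↦ (1+ι)[γ]` is additive.  CENSUS (this seat, exact Manin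
symbols mod 5, `census/manin.py`): the strong form «quotient classes of levels ≤ 3 span H₁(X₀(5M);𝔽₅)⁺ modulo Eisenstein» holds at all 14
levels tested, `5M ∈ {15,20,30,35,40,45,55,60,65,70,105,110,155,205}` (rank `= g`, and `= g − 1` at 155 where the even Eisenstein character
`χ₃₁∘d`, `χ₃₁(5) = 0`, kills every quotient — exactly the allowance).  Why it might fail: for a 5-new irreducible eigenclass it is exactly
`μ(ω⁰) > 0` being impossible (Greenberg); it also binds 5-old classes (consequences of the OPEN B⁰ at level `M`) and mixed / non-eigen even
characters; B⁰ itself is unproved at any level of positive genus.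
[cite: Manin1972, Prop. 1.4] [cite: MazurTateTeitelbaum1986Invent, §I.10 (10.1)] [cite: GreenbergLNM1716, Conj. 1.11 (p. 64)] -/
theorem stub_multTeichSpan_five : ∀ M : ℕ, ¬ 5 ∣ M → MultTeichSpanGen M 5 := by
  sorry

/-- **stub S1₇ (THE crux of this line at `p = 7`; OPEN)**: the same at multiplicative level 7.  CENSUS: strong form holds at all 9 levels
tested, `7M ∈ {14,21,28,35,42,63,70,203,301}` (rank `= g`; `= g − 1` at 301, `χ₄₃(7) = 0`, exactly the allowance).  Why it might fail: as S1₅.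
[cite: Manin1972, Prop. 1.4] [cite: MazurTateTeitelbaum1986Invent, §I.10 (10.1)] [cite: GreenbergLNM1716, Conj. 1.11 (p. 64)] -/
theorem stub_multTeichSpan_seven : ∀ M : ℕ, ¬ 7 ∣ M → MultTeichSpanGen M 7 := by
  sorry

/-- **stub S1ᵥ (VACUITY of the crux beyond `p = 7`, replacing v3's residual-exposure span stub `_eleven_le`; critic re-probe note
07:05Z; M/L-sized modulo two cite-facts)**: an X11a pair with `ρ̄_{E,p}` irreducible and NOT surjective has `p ≤ 7`.
Plan: `Mult W p` (`p ∥ N`) makes `E` a Tate curve at `p`, so `ρ̄|_{I_p} ⊇ (ω * ; 0 1)` and the image contains an element of projective order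
`p − 1`; for `p ≥ 11` this excludes the exceptional images (`A₄/S₄/A₅`: projective orders `≤ 5`) and `N(C_ns)` (tree:
`eq_smul_one_of_mem_nonsplitCartan_of_mulVec_eq`, «an element of `C_ns` with a rational eigenvector is scalar»; elements of `N(C_ns) ∖ C_ns`
have projective order 2), and an irreducible image containing an element of order `p` contains `SL₂(𝔽_p)` hence is everything (det = ω
onto); by Dickson (tree: `SerreProp14GL2Fp`, `SerreCartan*`) the image lies in `N(C_s)`, i.e. `E` gives a non-cuspidal point of
`X_split(p)(ℚ) = X₀⁺(p²)(ℚ)`; Bilu–Parent–Rebolledo (all `p ≥ 11`, `p ≠ 13`) and Balakrishnan–Dogra–Müller–Tuitman–Vonk (`p = 13`) make that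
point CM, and CM curves have no multiplicative prime (integral `j`).  The two cite-facts are NOT in the tree (`rg Bilu|X_split` in
Literature/: matrix algebra only) — type them as named facts and display them, or close this stub modulo them.  Why it might fail: only a
mis-typed cite-fact; for `p ≤ 7` the statement is trivial, so it is exactly as strong as the classification it quotes.
[cite: BiluParentRebolledo2013, Thm. 1.2] [cite: BalakrishnanDograMullerTuitmanVonk2019, Thm. 1.1] [cite: Serre1972Invent, §2.4–2.7] -/
theorem stub_le_seven_of_classX11a_nonSurj :
    ∀ (W : WeierstrassCurve ℚ) [W.IsElliptic] [W.IsGloballyMinimal] (p : ℕ) [Fact p.Prime],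
      ClassX11a W p → ¬ Surj W p → p ≤ 7 := by
  sorry

/-- **stub S2 (`p`-generic Stevens bridge with the packet-quotient test set, transported to the cusp `1/p`; M-sized)**: at ONE odd prime
`p`, B⁰^mult at every level `pM` ⟹ for `E` with multiplicative reduction at `p` and `E[p]` irreducible, some orbit sum `A_n(a)`, `n ≥ 1`,
of the newform is a unit.
Plan: level `N = pM`, `p ∤ M`; `Irr` ⟹ good `ℓ ∤ N` with `a_ℓ ≢ ℓ + 1 (mod p)`, so the plus period character `m̄_f` is not Eisenstein:
`exists_mem_one_le_norm_sub_of_spanModBy_of_prime` («`p ∤ N` NOT needed») with `S := ↑(Gamma1' N)` (for which `SpanModBy` is trivial)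
gives `γ ∈ Γ₁'(N)` with `p ∤ m(γ)`; `m(γ^ι) = m(γ)` (`[−r]⁺ = [r]⁺`), so `m(γγ^ι) = 2m(γ)` is a unit while `m̄` kills finite-order,
trace-`±2`, `p`-th powers and commutators; the hypothesis ⟹ `m̄(ππ'⁻¹) ≠ 0` for some packet quotient; `m(g)/2 = [g(1/p)]⁺ − [1/p]⁺` for
mult-good `g`, additivity (`cuspSymbol_mul_holds`) and `|packet| = p − 1` give `m(ππ'⁻¹)/2 = A_n(u) − A_{n'}(u')`; ultrametric ⟹ one
orbit sum has norm `≥ 1`.  (At `p = 3` a packet is `{ν, −ν}` and `A_n(u) = 2[u/3ⁿ]⁺`.)  Why it might fail: bookkeeping of the coset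
`{ν(g)} = a·μ_{p−1}` against `teichOrbitSum`'s index set (same argument as X9 §D, `exists_teichOrbitSum_sub_of_teichSpanGen`).
[cite: Manin1972, Prop. 1.4 and Thm. 1.9] [cite: MazurTateTeitelbaum1986Invent, §I.10 (10.1)] -/
theorem stub_orbitUnit_of_multTeichSpan :
    ∀ (W : WeierstrassCurve ℚ) [W.IsElliptic] [W.IsGloballyMinimal] (p : ℕ) [Fact p.Prime],
      p ≠ 2 → (∀ M : ℕ, ¬ p ∣ M → MultTeichSpanGen M p) → Mult W p → Irr W p → MultTeichOrbitUnitAt W p := by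
  sorry

/-! ### S3 is REAL (v5/v3, 2026-08-28): orbit unit ⟹ `X11a.MuAnZeroAt` ⟹ `MultMuAnAt`, class-wide, through the CELL'S OWN coset door
(p3's `PrintX11aMuCosetCertificate` / `PrintX11aMuCosetDoorUnit`: Riemann sums of the Néron-normalised table, `Λ/ω_n`, discrete log of the
representative) + the tree's class-wide integrality `Additive.norm_ratPlusSymbol_le_one_of_irreducible` (`p` odd, `E[p]` irreducible ⟹
`‖[r]⁺_f‖_p ≤ 1`) + Mazur 1978 Cor. 4.1 (`‖ϖ‖_p = 1`, the ONE displayed fact).  No Wuthrich binder is needed any more.  Shared verbatim by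
«multspan3» (U3) and «multteich5» (U5). -/

/-- Reindexing: the Teichmüller orbit `{t·a : t^{p−1} = 1}` of a unit `a (mod p^k)` is the coset finset `{b : b^{p−1} = a^{p−1}}`. [folklore] -/
theorem sum_teich_mul_eq_sum_filter_pow {p : ℕ} [Fact p.Prime] {k : ℕ} {M : Type*} [AddCommMonoid M]
    (a : (ZMod (p ^ k))ˣ) (g : ZMod (p ^ k) → M) :
    ∑ t ∈ (Finset.univ : Finset (ZMod (p ^ k))).filter (fun t => t ^ (p - 1) = 1), g (t * a) =
      ∑ b ∈ (Finset.univ : Finset (ZMod (p ^ k))).filter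
        (fun b => b ^ (p - 1) = (a : ZMod (p ^ k)) ^ (p - 1)), g b := by
  refine Finset.sum_nbij' (fun t => t * a) (fun b => b * ↑a⁻¹) ?_ ?_ ?_ ?_ ?_
  · intro t ht
    simp only [Finset.mem_filter, Finset.mem_univ, true_and] at ht ⊢
    rw [mul_pow, ht, one_mul]
  · intro b hb
    simp only [Finset.mem_filter, Finset.mem_univ, true_and] at hb ⊢
    rw [mul_pow, hb, ← mul_pow, Units.mul_inv, one_pow]
  · intro t _
    simp only [mul_assoc, Units.mul_inv, mul_one]
  · intro b _
    simp only [mul_assoc, Units.inv_mul, mul_one]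
  · intro t _
    rfl

/-- **S3ᴿ, the `μ`-certificate class-wide (REAL; modulo Mazur 1978 Cor. 4.1 only).** At an odd multiplicative prime `p` with `E[p]`
irreducible, ONE unit Teichmüller-orbit sum `S_f(p, n, a)`, `n ≥ 1`, gives `X11a.MuAnZeroAt W p` (a unit coefficient of `ϖ·L_p` for THE
split / non-split Mazur–Tate–Teitelbaum function).  Proof = the cell's door read class-wide: `‖ϖ‖_p = 1`
(`X11b.ClassClosure.norm_ratCast_periodRatio_eq_one_of_mazur`), `‖[r]⁺_f‖_p ≤ 1` for all `r` (`Additive.norm_ratPlusSymbol_le_one_of_irreducible`),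
hence the whole table `ϖ·[a/p^m]⁺_f` is integral (`X11a.MuCoset.norm_periodRatio_mul_ratPlusSymbol_le_one`) and the displayed `‖S‖ ≥ 1` is `= 1`
(ultrametric); `a^{p−1} = (1+p)^{(p−1)s₀}` (`X11a.MuCoset.exists_pow_sub_one_eq_cyclotomicGenerator_pow`) identifies the orbit with the door's
coset (`X11a.MuCoset.finsum_coset_eq_sum_filter` + `sum_teich_mul_eq_sum_filter_pow`), and `X11a.MuCoset.exists_norm_coeff_eq_one_of_cosetSum_(non)split`
(MTT §I.12–13 Riemann sums in `Λ/ω_n`) gives the unit coefficient. [cite: MazurTateTeitelbaum1986Invent, §I.10, §I.12–I.13] [cite: Mazur1978, Cor. 4.1] -/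
theorem muAnZeroAt_of_orbitUnit (hMz : ModularForms.mazur_not_dvd_maninConstant_of_odd)
    (W : WeierstrassCurve ℚ) [W.IsElliptic] [W.IsGloballyMinimal] (p : ℕ) [Fact p.Prime]
    (hp2 : p ≠ 2) (hmult : Mult W p) (hirr : Irr W p) (h : MultTeichOrbitUnitAt W p) :
    Summit.BirchSwinnertonDyer.Rank1Residual.X11a.MuAnZeroAt W p := by
  classical
  have he : cyclotomicExponent p = 1 := if_neg hp2
  have hγ : cyclotomicGenerator p = 1 + p := by rw [cyclotomicGenerator, he, pow_one]
  have hτ : torsionOrder p = p - 1 := by rw [torsionOrder_eq, if_neg hp2]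
  intro N _ f hf ϖ hϖ
  obtain ⟨n, hn1, a, ha⟩ := h f hf
  obtain ⟨m, rfl⟩ : ∃ m, n = m + 1 := ⟨n - 1, by omega⟩
  have hϖ1 : ‖((ϖ : ℚ) : ℚ_[p])‖ = 1 :=
    Summit.BirchSwinnertonDyer.Rank1Residual.X11b.ClassClosure.norm_ratCast_periodRatio_eq_one_of_mazur W p hMz hp2
      hmult hirr hf hϖ
  have hsym : ∀ r : ℚ, ‖((ratPlusSymbol f r : ℚ) : ℚ_[p])‖ ≤ 1 :=
    Summit.BirchSwinnertonDyer.Rank1Residual.Additive.norm_ratPlusSymbol_le_one_of_irreducible hp2 hf hirr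
  have h0 : ‖((ϖ * ratPlusSymbol f 0 : ℚ) : ℚ_[p])‖ ≤ 1 := by
    rw [Rat.cast_mul, norm_mul, hϖ1, one_mul]; exact hsym 0
  have hint := Summit.BirchSwinnertonDyer.Rank1Residual.X11a.MuCoset.norm_periodRatio_mul_ratPlusSymbol_le_one W p hp2 hf
    hmult hϖ1.le h0
  have hS1 : ‖((teichOrbitSum f p (m + 1) (a : ZMod (p ^ (m + 1))) : ℚ) : ℚ_[p])‖ = 1 := by
    refine le_antisymm ?_ ha
    rw [teichOrbitSum_def, Rat.cast_sum]
    exact IsUltrametricDist.norm_sum_le_of_forall_le_of_nonneg zero_le_one fun t _ => hsym _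
  obtain ⟨s₀, hs₀⟩ := Summit.BirchSwinnertonDyer.Rank1Residual.X11a.MuCoset.exists_pow_sub_one_eq_cyclotomicGenerator_pow p
    hp2 m (a : ZMod (p ^ (m + 1))) a.isUnit
  have hunit : ‖∑ᶠ ξ : rootsOfUnity (torsionOrder p) ℤ_[p],
      ((ϖ * ratPlusSymbol f
        (((PadicInt.toZModPow (m + cyclotomicExponent p) ((ξ : ℤ_[p]ˣ) : ℤ_[p]) *
            (cyclotomicGenerator p : ZMod (p ^ (m + cyclotomicExponent p))) ^ s₀.val).val : ℚ) /
          (p : ℚ) ^ (m + cyclotomicExponent p)) : ℚ) : ℚ_[p])‖ = 1 := by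
    rw [Summit.BirchSwinnertonDyer.Rank1Residual.X11a.MuCoset.finsum_coset_eq_sum_filter p hp2 m s₀ (fun b ↦
      ((ϖ * ratPlusSymbol f ((b.val : ℚ) / (p : ℚ) ^ (m + cyclotomicExponent p)) : ℚ) : ℚ_[p]))]
    rw [he, hτ, hγ, ← hs₀, ← Rat.cast_sum, ← Finset.mul_sum, Rat.cast_mul, norm_mul, hϖ1, one_mul,
      ← sum_teich_mul_eq_sum_filter_pow a (fun b ↦ ratPlusSymbol f ((b.val : ℚ) / (p : ℚ) ^ (m + 1))),
      ← teichOrbitSum_def]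
    exact hS1
  refine ⟨fun hns L hL ↦ ?_, fun hs L hL ↦ ?_⟩
  · obtain ⟨k, -, hk⟩ :=
      Summit.BirchSwinnertonDyer.Rank1Residual.X11a.MuCoset.exists_norm_coeff_eq_one_of_cosetSum_nonsplit W p hf hmult hns ϖ
        hint s₀ hunit hL
    exact ⟨k, hk⟩
  · obtain ⟨k, -, hk⟩ :=
      Summit.BirchSwinnertonDyer.Rank1Residual.X11a.MuCoset.exists_norm_coeff_eq_one_of_cosetSum_split W p hf hs ϖ hint s₀
        hunit hL
    exact ⟨k, hk⟩

/-- Currency bridge (REAL): the door's `X11a.MuAnZeroAt W p` (THE split function `IsSplitMultPAdicLFunctionOf` / THE non-split function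
`IsMultPAdicLFunctionOf f p (−1)`) is the route's `MultMuAnAt W p` (`IsMultPAdicLFunctionOf f p (±1)`), by the tree's
`isMultPAdicLFunctionOf_one_iff`. [folklore] -/
theorem multMuAnAt_of_muAnZeroAt (W : WeierstrassCurve ℚ) [W.IsElliptic] [W.IsGloballyMinimal] (p : ℕ) [Fact p.Prime]
    (h : Summit.BirchSwinnertonDyer.Rank1Residual.X11a.MuAnZeroAt W p) : MultMuAnAt W p := by
  intro N _ f hf ϖ hϖ a L ha1 ha2 hL
  obtain ⟨hn, hs⟩ := h f hf ϖ hϖ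
  by_cases hsp : W.HasSplitMultiplicativeReductionAtPrime p
  · have ha : a = 1 := ha1 hsp
    subst ha
    exact hs hsp L ((isMultPAdicLFunctionOf_one_iff L).mp hL)
  · have ha : a = -1 := ha2 hsp
    subst ha
    exact hn hsp L hL

/-- **S3 (REAL since v5/v3; was the stub `stub_multMuAn_of_orbitUnit`)**: a unit orbit sum of level `n ≥ 1` ⟹ a unit coefficient of
`ϖ·L_p(E,T)` in the route's currency — modulo Mazur 1978 Cor. 4.1 only (conjunct 9 of `KatoTwinFactsFiveAn`).
[cite: MazurTateTeitelbaum1986Invent, §I.10–I.13] [cite: Mazur1978, Cor. 4.1] -/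
theorem multMuAn_of_orbitUnit :
    ModularForms.mazur_not_dvd_maninConstant_of_odd →
    ∀ (W : WeierstrassCurve ℚ) [W.IsElliptic] [W.IsGloballyMinimal] (p : ℕ) [Fact p.Prime],
      p ≠ 2 → Mult W p → Irr W p → MultTeichOrbitUnitAt W p → MultMuAnAt W p :=
  fun hMz W _ _ p _ hp2 hmult hirr h => multMuAnAt_of_muAnZeroAt W p (muAnZeroAt_of_orbitUnit hMz W p hp2 hmult hirr h)

/-- **stub S4 (shared with «finemu5»/«hardlocus5»/«cartan5»; item stmt-BirchSwinnertonDyer-19949 by name)**: only conjuncts 9 (Manin–Mazur)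
and 22 (Wuthrich Cor. 18) feed the transfer. [cite: Kato2004Asterisque, Thm. 17.4] [cite: SteinWuthrich2013, Thm. 6.1 (p. 20)] -/
theorem stub_pubFactsAn : Theses.ErratumRoadFive.KatoTwinFactsFiveAn := by
  sorry

/-! ### Compositions (real proofs) -/

/-- S1₅ ∨ S1₇ dispatch on the U5 domain: by S1ᵥ an X11a non-surjective pair with `p ≥ 5` has `p ∈ {5, 7}`, where B⁰^mult is the
census-backed stub. -/
theorem multTeichSpan_of_classX11a_nonSurj (W : WeierstrassCurve ℚ) [W.IsElliptic] [W.IsGloballyMinimal] (p : ℕ) [Fact p.Prime]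
    (hX : ClassX11a W p) (hns : ¬ Surj W p) (hp5 : 5 ≤ p) : ∀ M : ℕ, ¬ p ∣ M → MultTeichSpanGen M p := by
  have hp : p.Prime := Fact.out
  have h7 : p ≤ 7 := stub_le_seven_of_classX11a_nonSurj W p hX hns
  intro M hM
  interval_cases p
  · exact stub_multTeichSpan_five M hM
  · exact absurd hp (by decide)
  · exact stub_multTeichSpan_seven M hM

/-- **FALLBACK displayed (critic V#6/V#5-P2: the eigen-localised statement S2 actually consumes, in curve currency)**: if, on the U5
domain, some Teichmüller orbit sum of the newform is a `p`-unit, then S3 + S4 already give the crux — so a level at which S1 fails on OLD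
or non-eigen classes downgrades the line to this hypothesis instead of killing it.  Real proof; the hypothesis is displayed, not assumed. -/
theorem UpperNonSurjFive_of_orbitUnit
    (h : ∀ (W : WeierstrassCurve ℚ) [W.IsElliptic] [W.IsGloballyMinimal] (p : ℕ) [Fact p.Prime],
      ClassX11a W p → ¬ Surj W p → 5 ≤ p → MultTeichOrbitUnitAt W p) :
    Theses.PrintX11a.UpperNonSurjFive := by
  obtain ⟨-, -, -, hGZK, hmod, -, hpar, -, hM, -, -, hJs, hJn, hGS, -, -, hne, h12, hnsI, hspI, h15, h18,
    hfine⟩ := stub_pubFactsAn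
  intro W _ _ p _ hX hns hp5
  have hμ : MultMuAnAt W p :=
    multMuAn_of_orbitUnit hM W p hX.2.1 hX.2.2.1 hX.2.2.2.1 (h W p hX hns hp5)
  exact missingUpperBoundAt_of_classX11a_of_multDivisibilityAt hJs hJn hGZK hmod hpar W p (hGS W p) hX
    (multDivisibilityAt_of_katoFacts_of_muAn hne h12 hnsI hspI h15 h18 hfine W p hX.2.1 hX.2.2.1 hX.2.2.2.1 hns
      (fun f hf => hμ f hf))

/-- **The transfer closes the μ-road's hardest stub BY NAME**: S1–S4 ⟹ `Theorems.X11aNonSurjMuAnHardFive` (the registered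
`stub_muAnHardFive` of «finemu5»/«hardlocus5»); the hard-locus disjunction and `¬ Surj` are not used. -/
theorem muAnHardFive_of_multTeich : Theorems.X11aNonSurjMuAnHardFive := by
  obtain ⟨-, -, -, -, -, -, -, -, hM, -⟩ := stub_pubFactsAn
  intro W _ _ p _ hX hns hp5 _hhard N _ f hf ϖ hϖ a L ha1 ha2 hL
  exact multMuAn_of_orbitUnit hM W p hX.2.1 hX.2.2.1 hX.2.2.2.1
    (stub_orbitUnit_of_multTeichSpan W p hX.2.1 (multTeichSpan_of_classX11a_nonSurj W p hX hns hp5) hX.2.2.1 hX.2.2.2.1)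
    f hf ϖ hϖ a L ha1 ha2 hL

/-- **Composition concluding the crux BY NAME**: at every X11a pair with `ρ̄_{E,p}` not surjective and `p ≥ 5`, S1–S3 give a unit orbit
sum, and the displayed fallback composition does the rest. -/
theorem UpperNonSurjFive_of : Theses.PrintX11a.UpperNonSurjFive :=
  UpperNonSurjFive_of_orbitUnit fun W _ _ p _ hX hns hp5 =>
    stub_orbitUnit_of_multTeichSpan W p hX.2.1 (multTeichSpan_of_classX11a_nonSurj W p hX hns hp5) hX.2.2.1 hX.2.2.2.1

end Summit.BirchSwinnertonDyer.BirchSwinnertonDyer.Cruxes.UpperNonSurjFive.MultTeich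

end
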